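import Literature.RepresentationTheory.Semisimple.KrullSchmidtIrreducible
import Mathlib.LinearAlgebra.TensorProduct.Basis
import Mathlib.LinearAlgebra.DirectSum.Finsupp
import Mathlib.Algebra.DirectSum.Finsupp
import HarnessLib

/-!
# Constituents of a module of Matsushima shape `H ≃ ⨁_π (F_π ⊗ M_π)`: they are the `F_π` with `M_π ≠ 0`, with multiplicity
# `dim M_π` — and every such `F_π` occurs

Topic `Literature/RepresentationTheory/Semisimple`; theorems only (no definition, no named fact), Mathlib generality.  Sequel to
`EquivariantIrreducibleDecomposition` (a module of Matsushima shape is semisimple) and `KrullSchmidtIrreducible` (Azumaya matching).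

Let `k` be a field, `A` a `k`-algebra (think `A = k[G]`), `F_π` (`π ∈ P`) `A`-modules with compatible `k`-structure and `M_π` plain
`k`-vector spaces («multiplicity spaces»), and let the `A`-module `H` be `A`-isomorphic to `⨁_π (F_π ⊗_k M_π)`, `A` acting on the
left factors — the SHAPE of Matsushima's formula `H^*(Γ; ℂ) = ⊕_π m(π,Γ) H^*(𝔤,K;H_{π,0})` [Borel–Wallach VII Thm. 3.2], of its
adelic/Hecke form, and of [Liu 2021, (D.1) / proof of Prop. 4.13 l. 2131] `H¹_{B,τ'}(A_∞, ℂ) ≃ ⊕_π m_disc(π)·H¹(𝔤,K_G;π_∞) ⊗ π^∞`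
(there `F_π = π^∞`, `M_π = m_disc(π)·H¹(𝔤,K_G;π_∞)_{τ'}`).  Then:

* `exists_linearEquiv_directSum_sigma` — choosing bases `(b_π)` of the `M_π`, `H ≃ ⨁_{(π, β)} F_π` `A`-linearly over
  `Σ π, (index of b_π)`: the multiplicity space is traded for `dim M_π` copies (Bourbaki, *Algèbre* II § 3 n° 7: tensoring with a free
  module = direct sum of copies; Mathlib `TensorProduct.finsuppScalarRight`);
* `exists_injective_linearMap_of_nontrivial` — **«`M_π ≠ 0 ⟹ π` contributes»**: if `M_π ≠ 0` there is an INJECTIVE `A`-linear map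
  `F_π → H` ([Liu2021, l. 2131]: «`π` contributes to the Albanese if `m_disc(π) > 0` and `H¹(𝔤, K_G; π_∞) ≠ {0}`»);
* `exists_equiv_sigma_of_linearEquiv_directSum` — **the constituents of ANY decomposition `H ≃ ⨁ᵢ Sᵢ` into SIMPLE modules are
  the `F_π`, through a bijection `ι ≃ Σ π, (index of b_π)`** (all `F_π` simple): Krull–Schmidt–Azumaya
  [Bourbaki, *Algèbre* VIII § 2 n° 4 Th. 1 Cor. 2] applied to the two decompositions; corollaries `exists_of_simple_constituent`
  (every simple constituent is `≅ F_π` for some `π` with `M_π ≠ 0` — the «constituent ⟹ contributes» half of the dictionary) and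
  `exists_constituent_of_nontrivial` (every `F_π` with `M_π ≠ 0` IS a constituent).

No finiteness anywhere (arbitrary `P`, arbitrary — possibly infinite-dimensional — `M_π`, arbitrary index sets).  Nothing is
asserted about any particular `H`: the Matsushima-shaped isomorphism is a HYPOTHESIS `e`.  NOT here: Matsushima's formula itself
(tree `BorelWallach2000.MatsushimaFormula`, dictionary level), the `(𝔤,K)`-cohomology, the pairwise non-isomorphy of the `F_π`
(so «multiplicity of `F_π` = `dim M_π`» is stated only through the bijection, class by class it would need `F_π ≇ F_π'`).

Consumer: the Hodge–CM formalisation (cell `hodgecm-mathlib`, binder `h413`, rows III-4′ «Matsushima at the pin» / B3-13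
«occurrence»): the junction «Matsushima-contributes» (`π` with `m_disc(π)·H¹(π_∞)_{τ'} ≠ 0` ⟹ `π^∞` occurs in `H¹_{B,τ'}`) and
the «constituent ⟹ automorphic» half of the oscillator-triple dictionary are these two theorems read at the pin's Matsushima
isomorphism.

## References
* [BorelWallach2000] A. Borel, N. Wallach, *Continuous cohomology, discrete subgroups, and representations of reductive groups*,
  2nd ed., AMS (2000), VII Thm. 3.2 (p. 143) — the shape.
* [Liu2021] Y. Liu, Camb. J. Math. 9 (2021), proof of Prop. 4.13, l. 2131 (FJcycle.tex) — the shape with Hecke action and the word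
  «contributes».
* [BourbakiAlgebreVIII2012] N. Bourbaki, *Algèbre* VIII § 2 n° 4 Th. 1 Cor. 2 — via the tree's `KrullSchmidtIrreducible`.
* [Lang2002] S. Lang, *Algebra*, XVI § 2 (tensor product with a free module is a direct sum of copies; basis `1 ⊗ bⱼ`).
-/

noncomputable section

open scoped DirectSum TensorProduct

namespace Literature.RepresentationTheory.Semisimple

universe uk uA uP uF uM uH uι v

variable {k : Type uk} [Field k] {A : Type uA} [Ring A] [Algebra k A]
variable {P : Type uP} (F : P → Type uF) [∀ p, AddCommGroup (F p)] [∀ p, Module k (F p)] [∀ p, Module A (F p)]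
  [∀ p, IsScalarTower k A (F p)]
  (M : P → Type uM) [∀ p, AddCommGroup (M p)] [∀ p, Module k (M p)]
variable {H : Type uH} [AddCommGroup H] [Module A H]

/-- **Trading multiplicity spaces for copies.**  If `H ≃ ⨁_π (F_π ⊗_k M_π)` `A`-linearly (`A` acting on the left factors), then,
for the chosen bases `b_π` of the `k`-spaces `M_π` (index types `B π`), `H ≃ ⨁_{(π,β) : Σ π, B π} F_π` `A`-linearly: per summand
`F ⊗_k M ≃ F ⊗_k (B →₀ k) ≃ (B →₀ F) ≃ ⨁_{B} F` (Mathlib `TensorProduct.finsuppScalarRight`, `finsuppLEquivDirectSum`), then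
re-index the double sum over the sigma type (`DirectSum.sigmaLcurryEquiv`).  Lang XVI § 2 (basis of `F ⊗ M` from a basis of the free
module `M`). [cite: Lang2002, XVI §2] -/
theorem exists_linearEquiv_directSum_sigma (e : H ≃ₗ[A] (⨁ p, (F p ⊗[k] M p))) :
    ∃ (B : P → Type uM) (_ : ∀ p, Module.Basis (B p) k (M p)),
      Nonempty (H ≃ₗ[A] (⨁ q : (Σ p, B p), F q.1)) := by
  classical
  let B : P → Type uM := fun p => Module.Free.ChooseBasisIndex k (M p)
  let b : ∀ p, Module.Basis (B p) k (M p) := fun p => Module.Free.chooseBasis k (M p)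
  -- per summand: `F p ⊗ M p ≃ₗ[A] ⨁ _ : B p, F p`
  let e₂ : ∀ p, (F p ⊗[k] M p) ≃ₗ[A] (⨁ _ : B p, F p) := fun p =>
    ((TensorProduct.AlgebraTensorModule.congr (LinearEquiv.refl A (F p)) (b p).repr).trans
      (TensorProduct.finsuppScalarRight k A (F p) (B p))).trans (finsuppLEquivDirectSum A (F p) (B p))
  -- all summands at once, then re-index over the sigma type
  let E₁ : (⨁ p, (F p ⊗[k] M p)) ≃ₗ[A] (⨁ p, ⨁ _ : B p, F p) := DFinsupp.mapRange.linearEquiv e₂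
  let E₂ : (⨁ q : (Σ p, B p), F q.1) ≃ₗ[A] (⨁ p, ⨁ _ : B p, F p) :=
    DirectSum.sigmaLcurryEquiv A (δ := fun p (_ : B p) => F p)
  exact ⟨B, b, ⟨e.trans (E₁.trans E₂.symm)⟩⟩

/-- **«`M_π ≠ 0 ⟹ π` contributes».**  If `H ≃ ⨁_π (F_π ⊗_k M_π)` `A`-linearly and the multiplicity space `M_π` is non-zero, then
`F_π` embeds `A`-linearly into `H` (`v ↦ e⁻¹(v ⊗ m₀)`, here through a basis vector `m₀ = b_π(β)`).  This is the reading of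
[Liu2021, proof of Prop. 4.13, l. 2131] «We say that an irreducible admissible representation `π` of `G(𝔸)` contributes to the
Albanese if `m_disc(π) > 0` and `H¹(𝔤, K_G; π_∞) ≠ {0}`» on the displayed isomorphism
`H¹_{B,τ'}(A_∞, ℂ) ≃ ⊕_π m_disc(π)·H¹(𝔤,K_G;π_∞) ⊗ π^∞` (there `F_π = π^∞`, `M_π` the multiplicity space).
[cite: Liu2021, proof of Prop. 4.13, l. 2131] -/
theorem exists_injective_linearMap_of_nontrivial (e : H ≃ₗ[A] (⨁ p, (F p ⊗[k] M p))) (p : P) [Nontrivial (M p)] :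
    ∃ f : F p →ₗ[A] H, Function.Injective f := by
  classical
  obtain ⟨B, b, ⟨E⟩⟩ := exists_linearEquiv_directSum_sigma F M e
  obtain ⟨β⟩ := (b p).index_nonempty
  refine ⟨E.symm.toLinearMap ∘ₗ DirectSum.lof A (Σ p, B p) (fun q => F q.1) ⟨p, β⟩, ?_⟩
  exact E.symm.injective.comp (DirectSum.of_injective (β := fun q : (Σ p, B p) => F q.1) ⟨p, β⟩)

variable [∀ p, IsSimpleModule A (F p)]
variable {ι : Type uι} {S : ι → Type v} [∀ i, AddCommGroup (S i)] [∀ i, Module A (S i)] [∀ i, IsSimpleModule A (S i)]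

/-- **The constituents of a Matsushima-shaped module.**  Let `H ≃ ⨁_π (F_π ⊗_k M_π)` `A`-linearly with all `F_π` SIMPLE, and let
`H ≃ ⨁ᵢ Sᵢ` be ANY `A`-linear decomposition into simple modules.  Then, for the chosen bases `b_π` of the `M_π` (index types `B π`),
there is a bijection `σ : ι ≃ Σ π, B π` with `Sᵢ ≃ F_{(σ i).1}` for every `i` — the constituents are the `F_π`, each appearing
`dim M_π` times as `π` and the basis vector vary.  Krull–Schmidt–Azumaya [Bourbaki, Algèbre VIII § 2 n° 4 Th. 1 Cor. 2] (tree
`exists_equiv_forall_nonempty_linearEquiv`) for the two decompositions `⨁ᵢ Sᵢ ≃ H ≃ ⨁_{(π,β)} F_π`.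
[cite: BourbakiAlgebreVIII2012, VIII §2 n°4 Th. 1 Cor. 2] -/
theorem exists_equiv_sigma_of_linearEquiv_directSum (e : H ≃ₗ[A] (⨁ p, (F p ⊗[k] M p))) (e' : H ≃ₗ[A] (⨁ i, S i)) :
    ∃ (B : P → Type uM) (_ : ∀ p, Module.Basis (B p) k (M p)) (σ : ι ≃ Σ p, B p),
      ∀ i, Nonempty (S i ≃ₗ[A] F (σ i).1) := by
  obtain ⟨B, b, ⟨E⟩⟩ := exists_linearEquiv_directSum_sigma F M e
  haveI : ∀ q : (Σ p, B p), IsSimpleModule A ((fun q : (Σ p, B p) => F q.1) q) := fun q => inferInstance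
  obtain ⟨σ, hσ⟩ := exists_equiv_forall_nonempty_linearEquiv (S := S) (T := fun q : (Σ p, B p) => F q.1) (e'.symm.trans E)
  exact ⟨B, b, σ, hσ⟩

/-- **Every simple constituent is an `F_π` with `M_π ≠ 0`** («constituent ⟹ contributes»): with `H ≃ ⨁_π (F_π ⊗_k M_π)` (all `F_π`
simple) and ANY decomposition `H ≃ ⨁ᵢ Sᵢ` into simple modules, each `Sᵢ` is `≅ F_π` for some `π` whose multiplicity space is
non-zero. [cite: BourbakiAlgebreVIII2012, VIII §2 n°4 Th. 1 Cor. 2] [cite: Liu2021, proof of Prop. 4.13, l. 2131] -/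
theorem exists_of_simple_constituent (e : H ≃ₗ[A] (⨁ p, (F p ⊗[k] M p))) (e' : H ≃ₗ[A] (⨁ i, S i)) (i : ι) :
    ∃ p : P, Nontrivial (M p) ∧ Nonempty (S i ≃ₗ[A] F p) := by
  obtain ⟨B, b, σ, hσ⟩ := exists_equiv_sigma_of_linearEquiv_directSum F M e e'
  exact ⟨(σ i).1, nontrivial_of_ne _ _ ((b (σ i).1).ne_zero (σ i).2), hσ i⟩

/-- **Every `F_π` with `M_π ≠ 0` is a constituent of every simple decomposition**: with `H ≃ ⨁_π (F_π ⊗_k M_π)` (all `F_π` simple),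
`M_π ≠ 0`, and ANY decomposition `H ≃ ⨁ᵢ Sᵢ` into simple modules, some `Sᵢ` is `≅ F_π`.
[cite: BourbakiAlgebreVIII2012, VIII §2 n°4 Th. 1 Cor. 2] [cite: Liu2021, proof of Prop. 4.13, l. 2131] -/
theorem exists_constituent_of_nontrivial (e : H ≃ₗ[A] (⨁ p, (F p ⊗[k] M p))) (e' : H ≃ₗ[A] (⨁ i, S i)) (p : P)
    [Nontrivial (M p)] : ∃ i : ι, Nonempty (S i ≃ₗ[A] F p) := by
  classical
  obtain ⟨B, b, σ, hσ⟩ := exists_equiv_sigma_of_linearEquiv_directSum F M e e'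
  obtain ⟨β⟩ := (b p).index_nonempty
  refine ⟨σ.symm ⟨p, β⟩, ?_⟩
  have h := hσ (σ.symm ⟨p, β⟩)
  rwa [Equiv.apply_symm_apply] at h

/-! ## Representation currency: `G`-equivariant `k`-linear decompositions `H ≃ ⨁_π (V_π ⊗ M_π)`, `G` acting on `V_π` -/

section Representation

variable {G : Type uA} [Monoid G]
variable {H' : Type uH} [AddCommGroup H'] [Module k H'] (τ : Representation k G H')
variable {V : P → Type uF} [∀ p, AddCommGroup (V p)] [∀ p, Module k (V p)] (ρ : ∀ p, Representation k G (V p))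

/-- Coordinatewise equivariance of a tensor-shaped decomposition read through the `k[G]`-module dictionary: transporting along
`V_π ⊗ M_π ≃ (ρ_π).asModule ⊗ M_π`, the vector `Ψ (τ g x)` is `of g • Ψ x` (`of g` acts by `ρ_π g ⊗ 1` on pure tensors,
`TensorProduct.smul_tmul'`; Lang XVIII § 1). [cite: Lang2002, XVIII §1] -/
theorem of_smul_mapRange_congr_asModuleEquiv_symm (Ψ : H' ≃ₗ[k] (⨁ p, (V p ⊗[k] M p)))
    (hΨ : ∀ (g : G) (x : H') (p : P), Ψ (τ g x) p = LinearMap.rTensor (M p) (ρ p g) (Ψ x p)) (g : G) (x : H') :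
    MonoidAlgebra.of k G g •
        (DFinsupp.mapRange.linearEquiv
            (fun p => TensorProduct.congr (ρ p).asModuleEquiv.symm (LinearEquiv.refl k (M p))) :
          (⨁ p, (V p ⊗[k] M p)) ≃ₗ[k] ⨁ p, ((ρ p).asModule ⊗[k] M p)) (Ψ x) =
      (DFinsupp.mapRange.linearEquiv
            (fun p => TensorProduct.congr (ρ p).asModuleEquiv.symm (LinearEquiv.refl k (M p))) :
          (⨁ p, (V p ⊗[k] M p)) ≃ₗ[k] ⨁ p, ((ρ p).asModule ⊗[k] M p)) (Ψ (τ g x)) := by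
  have hC : ∀ (p : P) (z : V p ⊗[k] M p),
      MonoidAlgebra.of k G g • TensorProduct.congr (ρ p).asModuleEquiv.symm (LinearEquiv.refl k (M p)) z =
        TensorProduct.congr (ρ p).asModuleEquiv.symm (LinearEquiv.refl k (M p)) (LinearMap.rTensor (M p) (ρ p g) z) := by
    intro p z
    induction z using TensorProduct.induction_on with
    | zero => simp only [map_zero, smul_zero]
    | tmul v m =>
      rw [LinearMap.rTensor_tmul, TensorProduct.congr_tmul, TensorProduct.congr_tmul, TensorProduct.smul_tmul',
        LinearEquiv.refl_apply, Representation.asModuleEquiv_symm_map_rho]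
    | add x y hx hy => simp only [smul_add, map_add, hx, hy]
  apply DFinsupp.ext
  intro p
  rw [DFinsupp.smul_apply, DFinsupp.mapRange.linearEquiv_apply, DFinsupp.mapRange.linearEquiv_apply,
    DFinsupp.mapRange_apply, DFinsupp.mapRange_apply, hΨ, hC]

/-- **Dictionary, tensor-shaped sums.**  A `k`-linear `Ψ : H ≃ ⨁_π (V_π ⊗_k M_π)` with `Ψ (τ g x)_π = (ρ_π g ⊗ 1) (Ψ x)_π` yields a
`k[G]`-linear isomorphism `τ.asModule ≃ ⨁_π ((ρ_π).asModule ⊗_k M_π)` (`k[G]` acting on the left factors) — Lang XVIII § 1's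
«representation = `k[G]`-module» read on the Matsushima shape; the action of `of g` on `(ρ_π).asModule ⊗ M_π` is `ρ_π g ⊗ 1` on pure
tensors (Mathlib `TensorProduct.smul_tmul'`, `Representation.asModuleEquiv_symm_map_rho`). [cite: Lang2002, XVIII §1] -/
theorem _root_.Representation.nonempty_asModule_linearEquiv_directSum_tensor (Ψ : H' ≃ₗ[k] (⨁ p, (V p ⊗[k] M p)))
    (hΨ : ∀ (g : G) (x : H') (p : P), Ψ (τ g x) p = LinearMap.rTensor (M p) (ρ p g) (Ψ x p)) :
    Nonempty (τ.asModule ≃ₗ[MonoidAlgebra k G] (⨁ p, ((ρ p).asModule ⊗[k] M p))) := by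
  classical
  -- `k`-linear identification of the summands with the `asModule` synonyms
  set A₁ : (⨁ p, (V p ⊗[k] M p)) ≃ₗ[k] (⨁ p, ((ρ p).asModule ⊗[k] M p)) :=
    DFinsupp.mapRange.linearEquiv fun p => TensorProduct.congr (ρ p).asModuleEquiv.symm (LinearEquiv.refl k (M p))
    with hA₁
  have hA : ∀ (g : G) (x : H'), MonoidAlgebra.of k G g • A₁ (Ψ x) = A₁ (Ψ (τ g x)) := fun g x => by
    rw [hA₁]
    exact of_smul_mapRange_congr_asModuleEquiv_symm M τ ρ Ψ hΨ g x
  let E₁ : τ.asModule ≃ₗ[k] (⨁ p, ((ρ p).asModule ⊗[k] M p)) := τ.asModuleEquiv.trans (Ψ.trans A₁)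
  have hE : ∀ (g : G) (y : τ.asModule), E₁ (MonoidAlgebra.of k G g • y) = MonoidAlgebra.of k G g • E₁ y := by
    intro g y
    obtain ⟨x, rfl⟩ : ∃ x : H', τ.asModuleEquiv.symm x = y := ⟨τ.asModuleEquiv y, by simp⟩
    rw [← Representation.asModuleEquiv_symm_map_rho]
    simp only [E₁, LinearEquiv.trans_apply, LinearEquiv.apply_symm_apply]
    rw [hA]
  -- `k[G]`-linearity from `G`-equivariance (the `of g` span `k[G]` over `k`), checked in place
  exact ⟨{ E₁ with
    map_smul' := fun a y => by
      change E₁ (a • y) = a • E₁ y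
      induction a using MonoidAlgebra.induction_on with
      | hM g => exact hE g y
      | hadd a b ha hb => rw [add_smul, map_add, ha, hb, add_smul]
      | hsmul r a ha => rw [smul_assoc, map_smul, ha, smul_assoc] }⟩

variable {ι' : Type uι} {W : ι' → Type v} [∀ i, AddCommGroup (W i)] [∀ i, Module k (W i)] (σ : ∀ i, Representation k G (W i))

/-- **Dictionary, plain sums.**  A coordinatewise `G`-equivariant `k`-linear `Ψ : H ≃ ⨁ᵢ Wᵢ` yields a `k[G]`-linear isomorphism
`τ.asModule ≃ ⨁ᵢ (σᵢ).asModule` (Lang XVIII § 1; the construction inside `Representation.exists_equiv_of_equivariant_directSum`,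
exported). [cite: Lang2002, XVIII §1] -/
theorem _root_.Representation.nonempty_asModule_linearEquiv_directSum (Ψ : H' ≃ₗ[k] (⨁ i, W i))
    (hΨ : ∀ (g : G) (x : H') (i : ι'), Ψ (τ g x) i = σ i g (Ψ x i)) :
    Nonempty (τ.asModule ≃ₗ[MonoidAlgebra k G] (⨁ i, (σ i).asModule)) := by
  classical
  set A₁ : (⨁ i, W i) ≃ₗ[k] (⨁ i, (σ i).asModule) :=
    DFinsupp.mapRange.linearEquiv fun i => (σ i).asModuleEquiv.symm with hA₁
  have hA : ∀ (g : G) (x : H'), MonoidAlgebra.of k G g • A₁ (Ψ x) = A₁ (Ψ (τ g x)) := fun g x => by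
    rw [hA₁]
    exact of_smul_mapRange_asModuleEquiv_symm τ σ Ψ hΨ g x
  let E₁ : τ.asModule ≃ₗ[k] (⨁ i, (σ i).asModule) := τ.asModuleEquiv.trans (Ψ.trans A₁)
  have hE : ∀ (g : G) (y : τ.asModule), E₁ (MonoidAlgebra.of k G g • y) = MonoidAlgebra.of k G g • E₁ y := by
    intro g y
    obtain ⟨x, rfl⟩ : ∃ x : H', τ.asModuleEquiv.symm x = y := ⟨τ.asModuleEquiv y, by simp⟩
    rw [← Representation.asModuleEquiv_symm_map_rho]
    simp only [E₁, LinearEquiv.trans_apply, LinearEquiv.apply_symm_apply]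
    rw [hA]
  exact ⟨{ E₁ with map_smul' := fun a y => map_smul_of_forall_of_smul E₁.toLinearMap hE a y }⟩

/-- **Dictionary, back**: a `k[G]`-linear isomorphism of `asModule`s is a `G`-equivariant `k`-linear isomorphism (Lang XVIII § 1).
[cite: Lang2002, XVIII §1] -/
theorem _root_.Representation.exists_equivariant_of_asModule_linearEquiv {X Y : Type*} [AddCommGroup X] [Module k X]
    [AddCommGroup Y] [Module k Y] (α : Representation k G X) (β : Representation k G Y)
    (L : α.asModule ≃ₗ[MonoidAlgebra k G] β.asModule) :
    ∃ f : X ≃ₗ[k] Y, ∀ (g : G) (x : X), f (α g x) = β g (f x) := by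
  refine ⟨α.asModuleEquiv.symm ≪≫ₗ L.restrictScalars k ≪≫ₗ β.asModuleEquiv, fun g x => ?_⟩
  simp only [LinearEquiv.trans_apply, LinearEquiv.restrictScalars_apply, Representation.asModuleEquiv_symm_map_rho,
    map_smul, Representation.asModuleEquiv_map_smul, Representation.asAlgebraHom_of]

/-- **«`M_π ≠ 0 ⟹ π` contributes», representation form.**  If `Ψ : H ≃ ⨁_π (V_π ⊗_k M_π)` is `k`-linear with `G` acting through
`ρ_π ⊗ 1` on the `π`-th summand and `M_π ≠ 0`, there is an INJECTIVE `G`-equivariant `k`-linear map `V_π → H` — [Liu2021, proof of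
Prop. 4.13, l. 2131]: `π` «contributes» when `m_disc(π) > 0` and `H¹(𝔤,K_G;π_∞) ≠ 0`, read on `H¹_{B,τ'}(A_∞,ℂ) ≃ ⊕_π (multiplicity) ⊗ π^∞`.
[cite: Liu2021, proof of Prop. 4.13, l. 2131] -/
theorem _root_.Representation.exists_injective_equivariant_of_nontrivial (Ψ : H' ≃ₗ[k] (⨁ p, (V p ⊗[k] M p)))
    (hΨ : ∀ (g : G) (x : H') (p : P), Ψ (τ g x) p = LinearMap.rTensor (M p) (ρ p g) (Ψ x p)) (p : P) [Nontrivial (M p)] :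
    ∃ j : V p →ₗ[k] H', Function.Injective j ∧ ∀ (g : G) (v : V p), j (ρ p g v) = τ g (j v) := by
  obtain ⟨E⟩ := Representation.nonempty_asModule_linearEquiv_directSum_tensor M τ ρ Ψ hΨ
  obtain ⟨f, hf⟩ := exists_injective_linearMap_of_nontrivial (A := MonoidAlgebra k G) (fun p => (ρ p).asModule) M E p
  let j : Representation.IntertwiningMap (ρ p) τ := (Representation.IntertwiningMap.equivLinearMapAsModule (ρ p) τ).symm f
  refine ⟨j.toLinearMap, ?_, fun g v => Representation.IntertwiningMap.isIntertwining (ρ p) τ j g v⟩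
  intro a b hab
  exact hf hab

/-- **The irreducible constituents of an equivariant Matsushima-shaped decomposition.**  Let `Ψ : H ≃ ⨁_π (V_π ⊗_k M_π)` be `k`-linear
with `G` acting through `ρ_π ⊗ 1`, all `ρ_π` IRREDUCIBLE, and let `Ψ' : H ≃ ⨁ᵢ Wᵢ` be ANY coordinatewise `G`-equivariant decomposition
into irreducible `σᵢ`.  Then, for the chosen bases of the `M_π` (index types `B π`), there is a bijection `e : ι ≃ Σ π, B π` with
`Wᵢ ≃ V_{(e i).1}` `G`-equivariantly — the constituents are the `ρ_π`, `dim M_π` times each.  Krull–Schmidt–Azumaya [Bourbaki,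
Algèbre VIII § 2 n° 4 Th. 1 Cor. 2] through the `k[G]`-module dictionary (Lang XVIII § 1).
[cite: BourbakiAlgebreVIII2012, VIII §2 n°4 Th. 1 Cor. 2] [cite: Lang2002, XVIII §1] -/
theorem _root_.Representation.exists_equiv_sigma_of_equivariant_directSum (hρ : ∀ p, (ρ p).IsIrreducible)
    (Ψ : H' ≃ₗ[k] (⨁ p, (V p ⊗[k] M p)))
    (hΨ : ∀ (g : G) (x : H') (p : P), Ψ (τ g x) p = LinearMap.rTensor (M p) (ρ p g) (Ψ x p))
    (hσ : ∀ i, (σ i).IsIrreducible) (Ψ' : H' ≃ₗ[k] (⨁ i, W i))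
    (hΨ' : ∀ (g : G) (x : H') (i : ι'), Ψ' (τ g x) i = σ i g (Ψ' x i)) :
    ∃ (B : P → Type uM) (_ : ∀ p, Module.Basis (B p) k (M p)) (e : ι' ≃ Σ p, B p),
      ∀ i, ∃ f : W i ≃ₗ[k] V (e i).1, ∀ (g : G) (w : W i), f (σ i g w) = ρ (e i).1 g (f w) := by
  haveI : ∀ p, IsSimpleModule (MonoidAlgebra k G) (ρ p).asModule := fun p =>
    (Representation.irreducible_iff_isSimpleModule_asModule _).mp (hρ p)
  haveI : ∀ i, IsSimpleModule (MonoidAlgebra k G) (σ i).asModule := fun i =>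
    (Representation.irreducible_iff_isSimpleModule_asModule _).mp (hσ i)
  obtain ⟨E⟩ := Representation.nonempty_asModule_linearEquiv_directSum_tensor M τ ρ Ψ hΨ
  obtain ⟨E'⟩ := Representation.nonempty_asModule_linearEquiv_directSum τ σ Ψ' hΨ'
  obtain ⟨B, b, e, he⟩ := exists_equiv_sigma_of_linearEquiv_directSum (A := MonoidAlgebra k G)
    (fun p => (ρ p).asModule) M (S := fun i => (σ i).asModule) E E'
  refine ⟨B, b, e, fun i => ?_⟩
  obtain ⟨L⟩ := he i
  exact Representation.exists_equivariant_of_asModule_linearEquiv (σ i) (ρ (e i).1) L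

/-- **Every irreducible constituent is some `ρ_π` with `M_π ≠ 0`** (representation form of «constituent ⟹ contributes»).
[cite: BourbakiAlgebreVIII2012, VIII §2 n°4 Th. 1 Cor. 2] [cite: Liu2021, proof of Prop. 4.13, l. 2131] -/
theorem _root_.Representation.exists_equiv_of_irreducible_constituent (hρ : ∀ p, (ρ p).IsIrreducible)
    (Ψ : H' ≃ₗ[k] (⨁ p, (V p ⊗[k] M p)))
    (hΨ : ∀ (g : G) (x : H') (p : P), Ψ (τ g x) p = LinearMap.rTensor (M p) (ρ p g) (Ψ x p))
    (hσ : ∀ i, (σ i).IsIrreducible) (Ψ' : H' ≃ₗ[k] (⨁ i, W i))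
    (hΨ' : ∀ (g : G) (x : H') (i : ι'), Ψ' (τ g x) i = σ i g (Ψ' x i)) (i : ι') :
    ∃ p : P, Nontrivial (M p) ∧ ∃ f : W i ≃ₗ[k] V p, ∀ (g : G) (w : W i), f (σ i g w) = ρ p g (f w) := by
  obtain ⟨B, b, e, he⟩ := Representation.exists_equiv_sigma_of_equivariant_directSum M τ ρ σ hρ Ψ hΨ hσ Ψ' hΨ'
  exact ⟨(e i).1, nontrivial_of_ne _ _ ((b (e i).1).ne_zero (e i).2), he i⟩

/-- **Every `ρ_π` with `M_π ≠ 0` is a constituent of every irreducible equivariant decomposition** (representation form).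
[cite: BourbakiAlgebreVIII2012, VIII §2 n°4 Th. 1 Cor. 2] [cite: Liu2021, proof of Prop. 4.13, l. 2131] -/
theorem _root_.Representation.exists_irreducible_constituent_equiv_of_nontrivial (hρ : ∀ p, (ρ p).IsIrreducible)
    (Ψ : H' ≃ₗ[k] (⨁ p, (V p ⊗[k] M p)))
    (hΨ : ∀ (g : G) (x : H') (p : P), Ψ (τ g x) p = LinearMap.rTensor (M p) (ρ p g) (Ψ x p))
    (hσ : ∀ i, (σ i).IsIrreducible) (Ψ' : H' ≃ₗ[k] (⨁ i, W i))
    (hΨ' : ∀ (g : G) (x : H') (i : ι'), Ψ' (τ g x) i = σ i g (Ψ' x i)) (p : P) [Nontrivial (M p)] :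
    ∃ i : ι', ∃ f : W i ≃ₗ[k] V p, ∀ (g : G) (w : W i), f (σ i g w) = ρ p g (f w) := by
  classical
  obtain ⟨B, b, e, he⟩ := Representation.exists_equiv_sigma_of_equivariant_directSum M τ ρ σ hρ Ψ hΨ hσ Ψ' hΨ'
  obtain ⟨β⟩ := (b p).index_nonempty
  refine ⟨e.symm ⟨p, β⟩, ?_⟩
  have h := he (e.symm ⟨p, β⟩)
  rwa [Equiv.apply_symm_apply] at h

end Representation

end Literature.RepresentationTheory.Semisimple

end
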